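import Mathlib.Analysis.SpecialFunctions.Exp

/-!
# `ClampedEntropyClock` (stmt-AtomisticToContinuum-15145): in-clock localisation vs. the clock's order of limits — quantifier shapes (negative helper file; no Theses declaration is asserted; from the item evidence `LEAD-c1-CYCLE2.md` §3′, lead prover-line-stmt-AtomisticToContinuum-15145-c1-0; sibling of `EnergyRowShapes.lean`)

The crux `TwoClocks.ClampedEntropyClock` encodes Yau's linear relative-entropy Gronwall fed by finite-window
large-deviation inputs at a rate `β` fixed before `N → ∞` (Gronwall factor `exp(t/β)`, per-unit-time price `ε/β`
of an input of precision `ε`, reached only for windows `τ ≥ τ₀(β, ε)`). Both lines offered for the crux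
(`IdeatorTwoSketch`, `Sketch`) LOCALISE the global-equilibrium collisional input INSIDE the one-window step: cells are
decoupled on the event that no influence crosses a corridor during the window, and the corrupted particles are
priced by an exponential moment of their number at the rate `κβ` (`κ = 3CV`: clamp level times the pathwise bound),
which must not exceed the admissible locality rate `lam₀(τ)` of the window. Two mild facts make this impossible
below a positive target: (a) `lam₀(τ) ≤ C′/τ` (in `τ` mean free times a perturbed particle corrupts `≍ τ` forecasts
directly), (b) the CLT lower bound `τ₀(β, ε) ≥ cβ/ε` (the window pressure of the clamped functional is `≥ cβ²/τ`).

This file kernel-checks the resulting shape obstruction and its resolution: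

* `localityCert_ge` — under (a) and (b), EVERY admissible bookkeeping choice `(β, ε, τ)` (input available:
  `τ₀ β ε ≤ τ`; locality available: `κβ ≤ lam₀ τ`) leaves the Gronwall certificate `exp(t/β)·t·(ε/β)` above the
  positive constant `cκt²/C′` — so no target below it is certified, whatever the free parameters;
* `localityCert_small_of_local` — with the collisional input docked under LOCAL Gibbs data (no locality
  constraint) the same certificate is driven below every `η > 0` (β = 1, then ε, then τ).

Information for the planner's restatement (local-Gibbs collisional docking node; no in-clock localisation); a
statement about the METHOD the lines encode, not about the truth of the crux.
-/

namespace Summit.AtomisticToContinuum.HydrodynamicLimit.Theorems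

namespace ClampedEntropyClockNegative

/-- Shape (a): the admissible locality rate of a window of `τ` mean free times is at most `C′/τ`. [folklore] -/
def LocalityRateShape (C' : ℝ) (lam₀ : ℝ → ℝ) : Prop :=
  ∀ τ : ℝ, 0 < τ → lam₀ τ ≤ C' / τ

/-- Shape (b): the CLT lower bound on the window needed by an LD input of precision `ε` at rate `β`:
`τ₀(β, ε) ≥ cβ/ε`. [folklore] -/
def WindowShape (c : ℝ) (τ₀ : ℝ → ℝ → ℝ) : Prop :=
  ∀ β ε : ℝ, 0 < β → 0 < ε → c * β / ε ≤ τ₀ β ε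

/-- What linear Gronwall certifies for the specific relative entropy at time `t` from `h_0 = 0` when the one-window
step is run at rate `β` with inputs of precision `ε`: the factor `exp(t/β)` times `t · ε/β`. [folklore] -/
noncomputable def localityCert (t β ε : ℝ) : ℝ :=
  Real.exp (t / β) * (t * (ε / β))

/-- **In-clock localisation certifies nothing below a positive level.** Under the shapes (a) and (b), for every
admissible choice — rate `β > 0`, precision `ε > 0`, window `τ` with the LD input available (`τ₀ β ε ≤ τ`) and the
locality estimate available at the rate the step needs (`κβ ≤ lam₀ τ`) — the certificate is at least `cκt²/C′`:
availability forces `cβ/ε ≤ τ ≤ C′/(κβ)`, i.e. `ε ≥ cκβ²/C′`, and `exp(t/β) ≥ t/β` does the rest. [folklore] -/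
theorem localityCert_ge {t c C' κ : ℝ} (ht : 0 < t) (hc : 0 < c) (hC' : 0 < C') (hκ : 0 < κ)
    {lam₀ : ℝ → ℝ} {τ₀ : ℝ → ℝ → ℝ} (ha : LocalityRateShape C' lam₀) (hb : WindowShape c τ₀)
    {β ε τ : ℝ} (hβ : 0 < β) (hε : 0 < ε) (hτ : 0 < τ)
    (hinput : τ₀ β ε ≤ τ) (hloc : κ * β ≤ lam₀ τ) :
    c * κ * t ^ 2 / C' ≤ localityCert t β ε := by
  -- availability of both estimates pins the window: `cβ/ε ≤ τ ≤ C′/(κβ)`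
  have h1 : c * β / ε ≤ τ := (hb β ε hβ hε).trans hinput
  have h2 : κ * β ≤ C' / τ := hloc.trans (ha τ hτ)
  have h2' : κ * β * τ ≤ C' := by rwa [le_div_iff₀ hτ] at h2
  -- hence `ε ≥ cκβ²/C′`
  have h3 : c * κ * β ^ 2 ≤ C' * ε := by
    have h1' : c * β ≤ τ * ε := by rwa [div_le_iff₀ hε] at h1
    nlinarith [mul_le_mul_of_nonneg_left h1' (mul_pos hκ hβ).le]
  have h3' : c * κ * β ^ 2 / C' ≤ ε := by
    rw [div_le_iff₀ hC']
    linarith [mul_comm C' ε]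
  -- and `exp(t/β) ≥ t/β`
  have h4 : t / β ≤ Real.exp (t / β) := by linarith [Real.add_one_le_exp (t / β)]
  have h5 : t * (c * κ * β ^ 2 / C' / β) ≤ t * (ε / β) :=
    mul_le_mul_of_nonneg_left (div_le_div_of_nonneg_right h3' hβ.le) ht.le
  have h6 : 0 ≤ t * (ε / β) := mul_nonneg ht.le (div_pos hε hβ).le
  unfold localityCert
  calc c * κ * t ^ 2 / C' = t / β * (t * (c * κ * β ^ 2 / C' / β)) := by
        field_simp
    _ ≤ t / β * (t * (ε / β)) := mul_le_mul_of_nonneg_left h5 (div_pos ht hβ).le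
    _ ≤ Real.exp (t / β) * (t * (ε / β)) := mul_le_mul_of_nonneg_right h4 h6

/-- **A local collisional docking node closes the bookkeeping.** Without the locality constraint (the collisional
input docked under local Gibbs data, as the kinetic one is), the certificate is driven below any `η > 0`: take
`β = 1`, then `ε = η/(2 t e^t)`, then any window `τ ≥ τ₀ 1 ε`. [folklore] -/
theorem localityCert_small_of_local {t : ℝ} (ht : 0 < t) (τ₀ : ℝ → ℝ → ℝ) (η : ℝ) (hη : 0 < η) :
    ∃ β : ℝ, 0 < β ∧ ∃ ε : ℝ, 0 < ε ∧ ∃ τ : ℝ, τ₀ β ε ≤ τ ∧ localityCert t β ε ≤ η := by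
  have he : 0 < Real.exp t := Real.exp_pos t
  refine ⟨1, one_pos, η / (2 * t * Real.exp t), by positivity, τ₀ 1 (η / (2 * t * Real.exp t)), le_rfl, ?_⟩
  unfold localityCert
  rw [div_one, div_one]
  calc Real.exp t * (t * (η / (2 * t * Real.exp t))) = η / 2 := by field_simp
    _ ≤ η := by linarith

end ClampedEntropyClockNegative

end Summit.AtomisticToContinuum.HydrodynamicLimit.Theorems
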